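import Summits.ValiantsHypothesis.ValiantsHypothesis.Theorems.BarrierLeverFormulaSliceRank
import Summits.ValiantsHypothesis.ValiantsHypothesis.Theorems.BarrierLeverNaturalProofsAgainstAllLinearSizesOfCountSize
import Summits.ValiantsHypothesis.ValiantsHypothesis.Theorems.BarrierLeverSingleSizeEquationsReductions
import Literature.Barriers.ValiantsHypothesis.AlgebraicNaturalProofs

/-!
# Route BarrierLever — the MODEL axis of item `SingleSizeEquations` (stmt-ValiantsHypothesis-8749):
# `poly(N)`-natural proofs against fan-in-two FORMULAS of quadratic size (part 2/2: the equations)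

Item 8749 (`∀ b ∃ a n₀ ∀ n ≥ n₀`: a nonzero level-`a` boolean sum in the `N = C(2n,n)` coefficient
variables vanishing on `coeff(SmallCircuits ℂ n b)`) is Chatterjee–Tengse 2023 §1.3 dir. 2 for
general circuits already at `b = 2`; on the size axis the tree has `b ≤ 1` and all linear sizes.
This file settles the FORMULA slice up to QUADRATIC size at ONE level, with `q = 0` boolean
variables: for every `n ≥ 10` the polynomial `formulaCert n` — the product over the `⌈n/2⌉`
block variables `y = x_{⌊n/2⌋+k}` of the `⌊n/2⌋ × ⌊n/2⌋` determinants of COEFFICIENT VARIABLES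
`c_{y^{j+1} x_l}` (`j, l < ⌊n/2⌋`) — is a nonzero member of `Distinguishers ℂ n 12` (degree
`≤ n²/4`, size `≤ 9 n⁸`) vanishing at `coeff(f)` for EVERY `f ∈ ℂ[x_1..x_n]` with
`formulaComplexity f ≤ n²/20` (`isNaturalProof_formulaCert`, `naturalProofsAgainstFormulasQuadratic`,
and the 8749-shaped `formulaSliceEquations`).  Vanishing is part 1
(`WExpr.exists_leafCount_krow_mem_span`, Kalorkoti's measure at the origin) plus pigeonhole over
the blocks: a formula with `S` gates has `≤ S + 1` leaves, so some block variable carries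
`d ≤ (S+1)/⌈n/2⌉` of them, and the rows of its matrix span a space of dimension `≤ 4d < ⌊n/2⌋` as
soon as `4(S+1) < ⌈n/2⌉⌊n/2⌋` (`eval_formulaCert_eq_zero`, which needs NO degree bound on `f`).
Non-vanishing: at the indicator point of the "diagonal" monomials `y^{j+1} x_j` every block matrix
evaluates to the identity (`eval_diagIndicator_formulaCert`).  By-product: the Kalorkoti lower
bound `formulaComplexity f > S` for every `f` at which `formulaCert n` does not vanish
(`lt_formulaComplexity_of_eval_ne_zero`).
WHAT THIS IS NOT: nothing on general circuits beyond `b ≤ 1` / linear sizes, on 8745/8749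
themselves (CT23 dir. 2, open), on 8746, FSV Question 6 (14610) or VP vs VNP; Kalorkoti's method
caps at `Σ_y rank ≤ n²` for `n`-variate polynomials of degree `≤ n` — super-quadratic formula
size is out of its reach.  References: Kalorkoti 1985; Forbes–Shpilka–Volk 2018 (Def. 1, Thm. 4).
-/

-- layout Summits/ValiantsHypothesis/ValiantsHypothesis forces the duplicated namespace component
set_option linter.dupNamespace false

noncomputable section

open MvPolynomial Finsupp

namespace Summit.ValiantsHypothesis.ValiantsHypothesis.Theorems.BarrierLever.FormulaSlice

open Literature.Computability.AlgebraicComplexity Literature.Barriers.ValiantsHypothesis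

/-! ## From rank to determinants -/

/-- A square matrix whose rows lie in the span of fewer vectors than it has rows is singular.
[folklore] -/
theorem det_eq_zero_of_rows_mem_span {F : Type*} [Field F] {R : Type*} [Fintype R]
    [DecidableEq R] (M : Matrix R R F) (G : Finset (R → F)) (hG : G.card < Fintype.card R)
    (hM : ∀ i, M i ∈ Submodule.span F (G : Set (R → F))) : M.det = 0 := by
  by_contra hdet
  have hli := Matrix.linearIndependent_rows_of_det_ne_zero hdet
  let f : R → Submodule.span F (G : Set (R → F)) := fun i => ⟨M i, hM i⟩
  have hli' : LinearIndependent F f :=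
    LinearIndependent.of_comp (Submodule.span F (G : Set (R → F))).subtype hli
  have h1 := hli'.fintype_card_le_finrank
  have h2 : Module.finrank F (Submodule.span F (G : Set (R → F))) ≤ G.card :=
    finrank_span_finset_le_card G
  omega

/-! ## The certificate -/

section cert

variable (n : ℕ)

/-- The `k`-th BLOCK variable `x_{⌊n/2⌋ + k}`, `k < ⌈n/2⌉`. [cite: Kalorkoti1985, §3] -/
def blockVar (k : Fin (n - n / 2)) : Fin n := ⟨n / 2 + k, by omega⟩

/-- The `l`-th COLUMN variable `x_l`, `l < ⌊n/2⌋`. [cite: Kalorkoti1985, §3] -/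
def colVar (l : Fin (n / 2)) : Fin n := ⟨l, by omega⟩

/-- The coefficient coordinate of the monomial `x_{⌊n/2⌋+k}^{j+1} · x_l` (degree `j + 2 ≤ n`).
[cite: Kalorkoti1985, §3] -/
def certMonomial (k : Fin (n - n / 2)) (j l : Fin (n / 2)) : degLEMonomials n :=
  ⟨Finsupp.single (blockVar n k) ((j : ℕ) + 1) + Finsupp.single (colVar n l) 1, by
    show Finsupp.degree _ ≤ n
    rw [map_add, Finsupp.degree_single, Finsupp.degree_single]
    have := j.2
    omega⟩

/-- The `k`-th **Kalorkoti matrix of coefficient variables** `(c_{y^{j+1} x_l})_{j,l < ⌊n/2⌋}`,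
`y = x_{⌊n/2⌋+k}`. [cite: Kalorkoti1985, §3] -/
def kalMatrix (k : Fin (n - n / 2)) :
    Matrix (Fin (n / 2)) (Fin (n / 2)) (MvPolynomial (degLEMonomials n) ℂ) :=
  Matrix.of fun j l => X (certMonomial n k j l)

/-- **The certificate against quadratic-size formulas**: the product over the `⌈n/2⌉` block
variables of the determinants of their Kalorkoti matrices. [cite: Kalorkoti1985, Thm. 1] -/
def formulaCert : MvPolynomial (degLEMonomials n) ℂ :=
  ∏ k : Fin (n - n / 2), (kalMatrix n k).det

variable {n}

/-- Column variables are not block variables. [folklore] -/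
theorem colVar_ne_blockVar (k : Fin (n - n / 2)) (l : Fin (n / 2)) : colVar n l ≠ blockVar n k := by
  intro h
  have := congrArg Fin.val h
  simp only [colVar, blockVar] at this
  omega

/-- `blockVar` is injective. [folklore] -/
theorem blockVar_injective : Function.Injective (blockVar n) := by
  intro k k' h
  have := congrArg Fin.val h
  simp only [blockVar] at this
  exact Fin.ext (by omega)

/-- The coordinates `c_{y^{j+1} x_l}` are pairwise distinct. [folklore] -/
theorem certMonomial_eq_iff {k k' : Fin (n - n / 2)} {j l j' l' : Fin (n / 2)} :
    certMonomial n k j l = certMonomial n k' j' l' ↔ k = k' ∧ j = j' ∧ l = l' := by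
  classical
  refine ⟨fun h => ?_, by rintro ⟨rfl, rfl, rfl⟩; rfl⟩
  have h' : (certMonomial n k j l : Fin n →₀ ℕ) = certMonomial n k' j' l' := congrArg Subtype.val h
  simp only [certMonomial] at h'
  have hk : k = k' := by
    by_contra hne
    have hb : blockVar n k' ≠ blockVar n k := fun h => hne (blockVar_injective h).symm
    have := DFunLike.congr_fun h' (blockVar n k)
    simp only [Finsupp.add_apply, Finsupp.single_apply, colVar_ne_blockVar, hb, if_false,
      if_true] at this
    omega
  subst hk
  have hj : j = j' := by
    have := DFunLike.congr_fun h' (blockVar n k)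
    simp only [Finsupp.add_apply, Finsupp.single_apply, colVar_ne_blockVar, if_false,
      if_true] at this
    exact Fin.ext (by omega)
  subst hj
  have hl : l = l' := by
    by_contra hne
    have hc : colVar n l' ≠ colVar n l := fun h =>
      hne (Fin.ext (by simpa [colVar] using congrArg Fin.val h)).symm
    have := DFunLike.congr_fun h' (colVar n l)
    simp only [Finsupp.add_apply, Finsupp.single_apply, (colVar_ne_blockVar k l).symm, hc,
      if_false, if_true] at this
    omega
  exact ⟨rfl, rfl, hl⟩

/-- Evaluating the certificate: the product of the determinants of the evaluated matrices.
[folklore] -/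
theorem eval_formulaCert (g : degLEMonomials n → ℂ) :
    eval g (formulaCert n) =
      ∏ k : Fin (n - n / 2), (Matrix.of fun j l => g (certMonomial n k j l)).det := by
  rw [formulaCert, map_prod]
  refine Finset.prod_congr rfl fun k _ => ?_
  rw [RingHom.map_det]
  congr 1
  ext j l
  simp [kalMatrix]

/-! ## Vanishing on quadratic-size formulas (Kalorkoti at the origin + pigeonhole) -/

/-- **The certificate vanishes at every polynomial with a small formula.**  If
`4 (E(f) + 1) < ⌈n/2⌉ · ⌊n/2⌋` (`E` = `formulaComplexity`, number of gates of a fan-in-two formula)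
then `formulaCert n` vanishes at `coeff(f)` — for EVERY `f ∈ ℂ[x_1..x_n]`, no degree bound needed.
[cite: Kalorkoti1985, Thm. 1] -/
theorem eval_formulaCert_eq_zero (f : MvPolynomial (Fin n) ℂ)
    (hf : 4 * (formulaComplexity f + 1) < (n - n / 2) * (n / 2)) :
    eval (coeffVector (degLEMonomials n) f) (formulaCert n) = 0 := by
  classical
  obtain ⟨e, he, hs⟩ := exists_wexpr_size_le_formulaComplexity f
  obtain ⟨d, hd, hrows⟩ := e.exists_leafCount_krow_mem_span (F := ℂ) (ι := Fin (n / 2))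
  -- pigeonhole over the blocks: some block variable carries few leaves
  have hsum : ∑ k : Fin (n - n / 2), d (blockVar n k) ≤ formulaComplexity f + 1 := by
    have h1 := hd (Finset.univ.image (blockVar n))
    rw [Finset.sum_image fun k _ k' _ h => blockVar_injective h] at h1
    exact h1.trans ((e.numVars_le_size_succ).trans (by omega))
  obtain ⟨k, hk⟩ : ∃ k : Fin (n - n / 2), 4 * d (blockVar n k) < n / 2 := by
    by_contra hcon
    push Not at hcon
    have : (n - n / 2) * (n / 2) ≤ 4 * ∑ k : Fin (n - n / 2), d (blockVar n k) := by
      rw [Finset.mul_sum]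
      calc (n - n / 2) * (n / 2) = ∑ _k : Fin (n - n / 2), n / 2 := by simp
        _ ≤ ∑ k : Fin (n - n / 2), 4 * d (blockVar n k) := Finset.sum_le_sum fun k _ => hcon k
    omega
  -- the rows of the `k`-th evaluated matrix lie in a space of dimension `< ⌊n/2⌋`
  obtain ⟨G, hG, hmem⟩ := hrows (blockVar n k) (colVar n) (colVar_ne_blockVar k)
  rw [eval_formulaCert]
  refine Finset.prod_eq_zero (Finset.mem_univ k) (det_eq_zero_of_rows_mem_span _ G ?_ fun j => ?_)
  · rw [Fintype.card_fin]; omega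
  · have hrow : (Matrix.of fun j l => coeffVector (degLEMonomials n) f (certMonomial n k j l)) j =
        krow (blockVar n k) (colVar n) ((j : ℕ) + 1) e.eval := by
      funext l
      rw [Matrix.of_apply, coeffVector_apply, krow_apply_eq_coeff _ _ (colVar_ne_blockVar k l), he]
      rfl
    rw [hrow]
    exact hmem _ (Nat.succ_le_succ (Nat.zero_le _))

/-- **Kalorkoti's lower bound, certificate form**: a polynomial at which `formulaCert n` does not
vanish has formula complexity `E(f)` with `⌈n/2⌉⌊n/2⌋ ≤ 4 (E(f) + 1)`. [cite: Kalorkoti1985, Thm. 1] -/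
theorem le_formulaComplexity_of_eval_ne_zero (f : MvPolynomial (Fin n) ℂ)
    (hf : eval (coeffVector (degLEMonomials n) f) (formulaCert n) ≠ 0) :
    (n - n / 2) * (n / 2) ≤ 4 * (formulaComplexity f + 1) := by
  by_contra h
  exact hf (eval_formulaCert_eq_zero f (by omega))

/-! ## Non-vanishing: the indicator point of the diagonal monomials -/

/-- The indicator of the "diagonal" coordinates `c_{y^{j+1} x_j}`. [folklore] -/
def diagIndicator (n : ℕ) : degLEMonomials n → ℂ := by
  classical
  exact fun m => if ∃ (k : Fin (n - n / 2)) (j : Fin (n / 2)), m = certMonomial n k j j then 1 else 0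

/-- At the diagonal indicator every Kalorkoti matrix evaluates to the identity. [folklore] -/
theorem diagIndicator_certMonomial (k : Fin (n - n / 2)) (j l : Fin (n / 2)) :
    diagIndicator n (certMonomial n k j l) = if j = l then 1 else 0 := by
  classical
  unfold diagIndicator
  by_cases hjl : j = l
  · subst hjl
    rw [if_pos ⟨k, j, rfl⟩, if_pos rfl]
  · rw [if_neg, if_neg hjl]
    rintro ⟨k', j', h⟩
    obtain ⟨-, h2, h3⟩ := certMonomial_eq_iff.mp h
    exact hjl (h2.trans h3.symm)

/-- **The certificate is not the zero polynomial**: it evaluates to `1` at the diagonal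
indicator. [cite: Kalorkoti1985, Thm. 1] -/
theorem eval_diagIndicator_formulaCert : eval (diagIndicator n) (formulaCert n) = 1 := by
  classical
  rw [eval_formulaCert]
  refine Finset.prod_eq_one fun k _ => ?_
  have h1 : (Matrix.of fun j l => diagIndicator n (certMonomial n k j l)) = 1 := by
    ext j l
    rw [Matrix.of_apply, diagIndicator_certMonomial, Matrix.one_apply]
  rw [h1, Matrix.det_one]

/-- `formulaCert n ≠ 0`. [cite: Kalorkoti1985, Thm. 1] -/
theorem formulaCert_ne_zero : formulaCert n ≠ 0 := by
  intro h
  have := eval_diagIndicator_formulaCert (n := n)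
  rw [h, map_zero] at this
  exact zero_ne_one this

/-! ## Size and degree: a level-12 distinguisher -/

/-- `deg (formulaCert n) ≤ ⌈n/2⌉ · ⌊n/2⌋` (each determinant has degree `≤ ⌊n/2⌋`). [folklore] -/
theorem totalDegree_formulaCert_le : (formulaCert n).totalDegree ≤ (n - n / 2) * (n / 2) := by
  classical
  refine (totalDegree_finsetProd _ _).trans ?_
  calc ∑ k : Fin (n - n / 2), ((kalMatrix n k).det).totalDegree
      ≤ ∑ _k : Fin (n - n / 2), n / 2 := Finset.sum_le_sum fun k _ =>
        (NaturalProofsAgainstAllLinearSizes.totalDegree_det_le_card _ fun i j => by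
          rw [kalMatrix, Matrix.of_apply, totalDegree_X]).trans
          (by rw [Fintype.card_fin])
    _ = (n - n / 2) * (n / 2) := by simp

/-- `L(formulaCert n) ≤ ⌈n/2⌉ · 8 (⌊n/2⌋ + 1)⁷ + ⌈n/2⌉` (Berkowitz for each determinant, entries are
variables). [folklore] -/
theorem complexity_formulaCert_le :
    complexity (formulaCert n) ≤ (n - n / 2) * (8 * (n / 2 + 1) ^ 7) + (n - n / 2) := by
  classical
  refine (complexity_finset_prod_le _ _).trans ?_
  rw [Finset.card_univ, Fintype.card_fin]
  refine Nat.add_le_add_right ?_ _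
  calc ∑ k : Fin (n - n / 2), complexity (kalMatrix n k).det
      ≤ ∑ _k : Fin (n - n / 2), 8 * (n / 2 + 1) ^ 7 := Finset.sum_le_sum fun k _ => by
        refine (NaturalProofsAgainstAllLinearSizes.complexity_det_le _ 0 fun i j => ?_).trans ?_
        · rw [kalMatrix, Matrix.of_apply, complexity_X_holds]
        · rw [Fintype.card_fin, mul_zero, add_zero]
    _ = (n - n / 2) * (8 * (n / 2 + 1) ^ 7) := by simp

/-- `2 ≤ C(2n,n)` and `n ≤ C(2n,n)` for `n ≥ 1`. [folklore] -/
theorem two_le_choose_and_le (hn : 1 ≤ n) : 2 ≤ (2 * n).choose n ∧ n ≤ (2 * n).choose n := by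
  have h : (2 * n).choose 1 ≤ (2 * n).choose n := by
    have := Nat.choose_le_middle 1 (2 * n)
    rwa [Nat.mul_div_right n two_pos] at this
  rw [Nat.choose_one_right] at h
  exact ⟨le_trans (by omega) h, le_trans (by omega) h⟩

/-- **Constructivity**: `formulaCert n ∈ Distinguishers ℂ n 12` for every `n ≥ 1` (size `≤ 9n⁸`,
degree `≤ n²`, `N = C(2n,n) ≥ max(2, n)`). [folklore] -/
theorem formulaCert_mem_distinguishers (hn : 1 ≤ n) : formulaCert n ∈ Distinguishers ℂ n 12 := by
  obtain ⟨h2, hN⟩ := two_le_choose_and_le hn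
  set N := (2 * n).choose n with hNdef
  have ht : n - n / 2 ≤ n := Nat.sub_le _ _
  have hR : n / 2 + 1 ≤ n := by omega
  have hn8 : n ^ 8 ≤ N ^ 8 := Nat.pow_le_pow_left hN 8
  have h16 : 16 ≤ N ^ 4 := by
    calc (16 : ℕ) = 2 ^ 4 := by norm_num
      _ ≤ N ^ 4 := Nat.pow_le_pow_left h2 4
  refine ⟨complexity_formulaCert_le.trans ?_, totalDegree_formulaCert_le.trans ?_⟩
  · calc (n - n / 2) * (8 * (n / 2 + 1) ^ 7) + (n - n / 2)
        ≤ n * (8 * n ^ 7) + n := Nat.add_le_add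
          (Nat.mul_le_mul ht (Nat.mul_le_mul_left 8 (Nat.pow_le_pow_left hR 7))) ht
      _ ≤ 9 * n ^ 8 := by
          have : n ≤ n ^ 8 := Nat.le_self_pow (by norm_num) n
          nlinarith
      _ ≤ N ^ 4 * N ^ 8 := Nat.mul_le_mul (le_trans (by norm_num) h16) hn8
      _ = N ^ 12 := by rw [← pow_add]
  · calc (n - n / 2) * (n / 2) ≤ n * n := Nat.mul_le_mul ht (Nat.div_le_self _ _)
      _ = n ^ 2 := (sq n).symm
      _ ≤ N ^ 2 := Nat.pow_le_pow_left hN 2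
      _ ≤ N ^ 12 := Nat.pow_le_pow_right (by omega) (by norm_num)

/-! ## The natural proof against quadratic-size formulas -/

/-- **Natural proof against formulas (one level, quadratic size).**  For every `n` and `S` with
`4 (S + 1) < ⌈n/2⌉ ⌊n/2⌋`, `formulaCert n` is a `Distinguishers ℂ n 12`-natural proof against the
slice `{f : deg f ≤ n, E(f) ≤ S}` of polynomials with fan-in-two formulas of at most `S` gates.
[cite: Kalorkoti1985, Thm. 1] -/
theorem isNaturalProof_formulaCert {S : ℕ} (hS : 4 * (S + 1) < (n - n / 2) * (n / 2)) :
    IsNaturalProof (degLEMonomials n)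
      {f : MvPolynomial (Fin n) ℂ | f.totalDegree ≤ n ∧ formulaComplexity f ≤ S}
      (Distinguishers ℂ n 12) (formulaCert n) := by
  have hn : 1 ≤ n := by
    by_contra h
    have h0 : n / 2 = 0 := by omega
    rw [h0, mul_zero] at hS
    exact Nat.not_lt_zero _ hS
  refine ⟨formulaCert_mem_distinguishers hn, formulaCert_ne_zero, fun f hf => ?_⟩
  exact eval_formulaCert_eq_zero f (by have := hf.2; omega)

/-- The formula slice is not a succinct hitting set for `Distinguishers ℂ n 12` once
`4 (S + 1) < ⌈n/2⌉ ⌊n/2⌋`. [cite: ForbesShpilkaVolk2018, Thm. 4] -/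
theorem not_isSuccinctHittingSet_formulas {S : ℕ} (hS : 4 * (S + 1) < (n - n / 2) * (n / 2)) :
    ¬ IsSuccinctHittingSet (degLEMonomials n)
      {f : MvPolynomial (Fin n) ℂ | f.totalDegree ≤ n ∧ formulaComplexity f ≤ S}
      (Distinguishers ℂ n 12) :=
  (exists_isNaturalProof_iff _ _ _).mp ⟨_, isNaturalProof_formulaCert hS⟩

/-- The arithmetic of the headline threshold: `4 (n²/20 + 1) < ⌈n/2⌉ ⌊n/2⌋` for `n ≥ 10`.
[folklore] -/
theorem four_mul_sq_div_twenty_succ_lt (hn : 10 ≤ n) : 4 * (n * n / 20 + 1) < (n - n / 2) * (n / 2) := by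
  rcases Nat.even_or_odd' n with ⟨m, hm | hm⟩
  · have hm5 : 5 ≤ m := by omega
    have hQ : 25 ≤ m * m := Nat.mul_le_mul hm5 hm5
    rw [hm, show 2 * m / 2 = m by omega, show 2 * m - m = m by omega,
      show 2 * m * (2 * m) = 4 * (m * m) by ring]
    generalize m * m = Q at hQ ⊢
    omega
  · have hm5 : 5 ≤ m := by omega
    have hQ : 25 ≤ m * m := Nat.mul_le_mul hm5 hm5
    have hQ' : 5 * m ≤ m * m := Nat.mul_le_mul_right m hm5
    rw [hm, show (2 * m + 1) / 2 = m by omega, show 2 * m + 1 - m = m + 1 by omega,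
      show (2 * m + 1) * (2 * m + 1) = 4 * (m * m) + 4 * m + 1 by ring,
      show (m + 1) * m = m * m + m by ring]
    generalize m * m = Q at hQ hQ' ⊢
    omega

end cert

/-- **HEADLINE — natural proofs against quadratic-size formulas, one level.**  There are `a`
(`= 12`) and `n₀` (`= 10`) such that for every `n ≥ n₀` the degree-`≤ n` polynomials in `n`
variables with fan-in-two formula complexity `≤ n²/20` are NOT a succinct hitting set for
`Distinguishers ℂ n a`; i.e. the matrix of item 8749 holds on the formula slice for every size
`n^b`, `b < 2` (indeed up to `n²/20`), at one level.  Kalorkoti's method (1985), made FSV-natural.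
[cite: Kalorkoti1985, Thm. 1] -/
theorem naturalProofsAgainstFormulasQuadratic : ∃ a n₀ : ℕ, ∀ n ≥ n₀,
    ¬ IsSuccinctHittingSet (degLEMonomials n)
      {f : MvPolynomial (Fin n) ℂ | f.totalDegree ≤ n ∧ formulaComplexity f ≤ n * n / 20}
      (Distinguishers ℂ n a) :=
  ⟨12, 10, fun _ hn => not_isSuccinctHittingSet_formulas (four_mul_sq_div_twenty_succ_lt hn)⟩

/-- **The 8749-shaped statement on the formula slice** (boolean-sum form, `q = 0` boolean
variables): for all `n ≥ 10` a nonzero level-`12` boolean sum in the coefficient variables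
vanishes at `coeff(f)` for every `f` of degree `≤ n` with `formulaComplexity f ≤ n²/20` — item
`SingleSizeEquations` with `SmallCircuits ℂ n b` replaced by the fan-in-two-formula slice, for all
`b < 2` at once. [cite: Kalorkoti1985, Thm. 1] -/
theorem formulaSliceEquations : ∃ a n₀ : ℕ, ∀ n ≥ n₀, ∃ q : ℕ, q ≤ (Nat.choose (2 * n) n) ^ a ∧
    ∃ H : MvPolynomial (↥(degLEMonomials n) ⊕ Fin q) ℂ,
      complexity H ≤ (Nat.choose (2 * n) n) ^ a ∧ H.totalDegree ≤ (Nat.choose (2 * n) n) ^ a ∧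
      boolSum H ≠ 0 ∧
      ∀ f : MvPolynomial (Fin n) ℂ, f.totalDegree ≤ n → formulaComplexity f ≤ n * n / 20 →
        eval (coeffVector (degLEMonomials n) f) (boolSum H) = 0 := by
  refine ⟨12, 10, fun n hn => ⟨0, Nat.zero_le _, MvPolynomial.rename Sum.inl (formulaCert n), ?_⟩⟩
  obtain ⟨hD, hne, hvan⟩ := isNaturalProof_formulaCert (four_mul_sq_div_twenty_succ_lt hn)
  obtain ⟨hc, hdeg, hsum⟩ := SingleSizeEquations.distinguisher_isBoolSum hD
  refine ⟨hc, hdeg, by rwa [hsum], fun f hf hE => ?_⟩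
  rw [hsum]
  exact hvan f ⟨hf, hE⟩

end Summit.ValiantsHypothesis.ValiantsHypothesis.Theorems.BarrierLever.FormulaSlice

end
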